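import Summits.QuantumFields.YangMills.Theses.SandwichVariancePinching

/-!
# Route `SandwichVariancePinching` — support `GaussianVarianceNonneg` (stmt-QuantumFields-28262), PROVED:
# the Gaussian proxy variance `2·tr(H₀⁻¹HH₀⁻¹H) + bᵀH₀⁻¹b` of a quadratic-plus-linear form is non-negative

For `H₀` positive definite and `H` symmetric (real `n × n`), `rV_q = 2·tr(H₀⁻¹ H H₀⁻¹ H) + bᵀ H₀⁻¹ b ≥ 0` — it is the variance of
`q(x) = xᵀHx + bᵀx` under the centred Gaussian `N(0, H₀⁻¹)`, but the proof here is plain linear algebra: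
* §1 `trace_mul_nonneg_of_posSemidef`: `tr(P·Q) ≥ 0` for positive semidefinite `P`, `Q` — write `Q = S·S` with `S = √Q` the positive
  square root of the continuous functional calculus (`CFC.sqrt`, Mathlib's `MatrixOrder` scope), so `tr(PQ) = tr(S P S) = tr(Sᴴ P S) ≥ 0`.
* §2 the item: `P = H₀⁻¹ ≽ 0` (`Matrix.PosDef.inv`), `H P H = Hᴴ P H ≽ 0`, `H₀⁻¹HH₀⁻¹H = P·(HPH)`, and `bᵀPb ≥ 0`.

HONEST SCOPE.  A routine load-bearing support of a DRAFT sub-line (planner ym-idea-3 g12, LINE 2) onto the open crux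
`LogConcaveChart.QuadraticCovarianceComparison`; the cruxes `QuadraticVarianceCeiling` / `QuadraticVarianceFloor`, the support
`SandwichMoments`, that crux, rung R2a and every summit statement stay open; nothing here bears on the Yang–Mills mass gap.
-/

namespace Summit.QuantumFields.YangMills.Theorems

open scoped Matrix MatrixOrder

namespace SandwichVariancePinching

/-- **`tr(P·Q) ≥ 0` for positive semidefinite real matrices `P`, `Q`.**  With `S = √Q` (continuous functional calculus square root,
`S ≽ 0`, `S·S = Q`, `Sᴴ = S`): `tr(PQ) = tr(S·S·P) = tr(S P S) = tr(Sᴴ P S) ≥ 0`, the last matrix being positive semidefinite.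
[folklore] -/
theorem trace_mul_nonneg_of_posSemidef {n : Type*} [Fintype n] [DecidableEq n] {P Q : Matrix n n ℝ}
    (hP : P.PosSemidef) (hQ : Q.PosSemidef) : 0 ≤ (P * Q).trace := by
  set S : Matrix n n ℝ := CFC.sqrt Q with hS
  have hSpsd : S.PosSemidef := Matrix.nonneg_iff_posSemidef.mp (CFC.sqrt_nonneg Q)
  have hSS : S * S = Q := CFC.sqrt_mul_sqrt_self Q (Matrix.nonneg_iff_posSemidef.mpr hQ)
  have hSherm : Sᴴ = S := hSpsd.1
  calc (0 : ℝ) ≤ (Sᴴ * P * S).trace := (hP.conjTranspose_mul_mul_same S).trace_nonneg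
    _ = (P * Q).trace := by rw [hSherm, Matrix.trace_mul_cycle, hSS, Matrix.trace_mul_comm]

end SandwichVariancePinching

/-- **SUPPORT `GaussianVarianceNonneg` of route `SandwichVariancePinching` (stmt-QuantumFields-28262), PROVED:** for `H₀` positive
definite and `H` symmetric, `0 ≤ 2·tr(H₀⁻¹ H H₀⁻¹ H) + bᵀ H₀⁻¹ b`.  `P = H₀⁻¹` is positive semidefinite, `H₀⁻¹HH₀⁻¹H = P·(HᴴPH)` with
`HᴴPH ≽ 0`, so the trace is `≥ 0` by `trace_mul_nonneg_of_posSemidef`, and `bᵀPb ≥ 0`.  (It is the variance of `xᵀHx + bᵀx` under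
`N(0, H₀⁻¹)`.)  The route's cruxes, its other support, the target crux of `LogConcaveChart` and every summit statement stay open.
[folklore] -/
theorem sandwichVariancePinching_gaussianVarianceNonneg_proof :
    Summit.QuantumFields.YangMills.Theses.SandwichVariancePinching.GaussianVarianceNonneg := by
  intro n H₀ H b hH₀ hH
  have hP : (H₀⁻¹).PosSemidef := hH₀.inv.posSemidef
  have hHc : Hᴴ = H := by
    rw [Matrix.conjTranspose_eq_transpose_of_trivial]
    exact hH
  have hQ : (H * H₀⁻¹ * H).PosSemidef := by
    have h := hP.conjTranspose_mul_mul_same H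
    rwa [hHc] at h
  have htr : 0 ≤ (H₀⁻¹ * H * H₀⁻¹ * H).trace := by
    have h := SandwichVariancePinching.trace_mul_nonneg_of_posSemidef hP hQ
    rwa [← Matrix.mul_assoc, ← Matrix.mul_assoc] at h
  have hb : 0 ≤ b ⬝ᵥ H₀⁻¹.mulVec b := by
    have h := hP.dotProduct_mulVec_nonneg b
    rwa [star_trivial] at h
  positivity

end Summit.QuantumFields.YangMills.Theorems
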